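import Summits.AnomalousDissipation.AnomalousDissipation.Theorems.BaireTransferRobustLoudUpgradeLine

/-!
# Line `malkin-cone-group-orbits`, companion c4: the CATEGORY form of the Baire target (planner side-deliverable)
# (crux `BaireTransfer.RobustLoudUpgrade`, stmt-AnomalousDissipation-1144)

Pure topology, registered sub-goal `category_transfer`.  The route reaches its target `U ⊆ closure (interior LOUD_j)` (all `j`) from
DENSITY of `LOUD_j` in `U` (crux #2) and the pointwise upgrade `LOUD ⊆ closure (interior LOUD₂)` (crux #3, this item).  For a set `L`
which is a countable union of closed sets — which `LOUD_j(S,E,ε)` is: the witnesses with `ν ≥ 1/n`, period, `‖c‖` and `H¹`-norm `≤ n`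
form a compact family with closed projection (NOT proved here; it enters only as the hypothesis `hL`) — the target inclusion over an
open `U` of a Baire space is EQUIVALENT to: `L` is non-meagre in every non-empty open subset of `U`
(`subset_closure_interior_iff_not_isMeagre`).  So the upgrade crux is exactly the bridge "dense ⇒ nowhere meagre", and no input giving
only density (a dense set may be meagre) can replace it.  References: Oxtoby, *Measure and Category* (1980) Ch. 9; the route file
(items 1143–1145).
-/

-- `Summit.<Summit>.<Problem>` is the tree's mandated summit-side namespace (CONVENTIONS §2); for this
-- single-conjunct summit the two coincide, so the duplicate is deliberate.
set_option linter.dupNamespace false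

noncomputable section

open scoped Topology
open Filter Set Function TopologicalSpace

namespace Summit.AnomalousDissipation.AnomalousDissipation.Theorems.RobustLoudUpgrade.CategoryTransfer

/-- If an open set `W` misses `interior L`, then for every closed `K ⊆ L` the trace `K ∩ W` is nowhere dense. [folklore] -/
theorem isNowhereDense_inter {X : Type*} [TopologicalSpace X] {L W K : Set X}
    (hdis : interior L ∩ W = ∅) (hK : IsClosed K) (hKL : K ⊆ L) : IsNowhereDense (K ∩ W) := by
  rw [isNowhereDense_iff_forall_notMem_nhds]
  intro y hy hny
  -- `closure (K ∩ W) ⊆ K ∩ closure W`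
  have hcl : closure (K ∩ W) ⊆ K ∩ closure W := fun z hz =>
    ⟨hK.closure_subset (closure_mono Set.inter_subset_left hz), closure_mono Set.inter_subset_right hz⟩
  -- so `y ∈ interior K ⊆ interior L`, an open set missing `W`, while `y ∈ W`
  have hyK : K ∈ 𝓝 y := Filter.mem_of_superset hny (hcl.trans Set.inter_subset_left)
  have hyL : y ∈ interior L := interior_mono hKL (mem_interior_iff_mem_nhds.2 hyK)
  have : y ∈ interior L ∩ W := ⟨hyL, hy.2⟩
  rw [hdis] at this
  exact this

/-- **One direction, any space**: if `L = ⋃ₙ Kₙ` with all `Kₙ` closed and `L` is non-meagre in every non-empty open subset of the open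
set `U`, then `U ⊆ closure (interior L)`. [folklore] -/
theorem subset_closure_interior_of_not_isMeagre {X : Type*} [TopologicalSpace X] {L U : Set X} {K : ℕ → Set X}
    (hK : ∀ n, IsClosed (K n)) (hL : L = ⋃ n, K n) (hU : IsOpen U)
    (h : ∀ V : Set X, IsOpen V → V.Nonempty → V ⊆ U → ¬ IsMeagre (L ∩ V)) :
    U ⊆ closure (interior L) := by
  intro x hx
  by_contra hxc
  -- the open set `V := U \ closure (interior L)` contains `x` and misses `interior L`
  set V : Set X := U ∩ (closure (interior L))ᶜ with hV
  have hVo : IsOpen V := hU.inter isClosed_closure.isOpen_compl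
  have hxV : x ∈ V := ⟨hx, hxc⟩
  have hdis : interior L ∩ V = ∅ := by
    refine Set.eq_empty_of_forall_notMem fun y hy => hy.2.2 (subset_closure hy.1)
  -- `L ∩ V = ⋃ₙ (Kₙ ∩ V)` is a countable union of nowhere dense sets, hence meagre
  have hmeag : IsMeagre (L ∩ V) := by
    have e : L ∩ V = ⋃ n, (K n ∩ V) := by rw [hL, Set.iUnion_inter]
    rw [e]
    exact isMeagre_iUnion fun n =>
      (isNowhereDense_inter hdis (hK n) (hL ▸ Set.subset_iUnion K n)).isMeagre
  exact h V hVo ⟨x, hxV⟩ Set.inter_subset_left hmeag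

/-- **The other direction, Baire spaces**: `U ⊆ closure (interior L)` makes `L` non-meagre in every non-empty open `V ⊆ U`
(a non-empty open subset of `interior L ∩ V` would be meagre). [folklore] -/
theorem not_isMeagre_of_subset_closure_interior {X : Type*} [TopologicalSpace X] [BaireSpace X] {L U : Set X}
    (h : U ⊆ closure (interior L)) {V : Set X} (hVo : IsOpen V) (hVne : V.Nonempty) (hVU : V ⊆ U) :
    ¬ IsMeagre (L ∩ V) := by
  intro hmeag
  obtain ⟨x, hx⟩ := hVne
  obtain ⟨y, hyV, hyL⟩ := mem_closure_iff.1 (h (hVU hx)) V hVo hx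
  have hWo : IsOpen (V ∩ interior L) := hVo.inter isOpen_interior
  have hne : (V ∩ interior L).Nonempty := ⟨y, hyV, hyL⟩
  have hsub : V ∩ interior L ⊆ L ∩ V := fun z hz => ⟨interior_subset hz.2, hz.1⟩
  exact not_isMeagre_of_isOpen hWo hne (hmeag.mono hsub)

/-- **The category form of the target inclusion** (Baire space, `L` an `F_σ`, `U` open):
`U ⊆ closure (interior L)` iff `L` is non-meagre in every non-empty open subset of `U`. [folklore] -/
theorem subset_closure_interior_iff_not_isMeagre {X : Type*} [TopologicalSpace X] [BaireSpace X] {L U : Set X}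
    {K : ℕ → Set X} (hK : ∀ n, IsClosed (K n)) (hL : L = ⋃ n, K n) (hU : IsOpen U) :
    U ⊆ closure (interior L) ↔ ∀ V : Set X, IsOpen V → V.Nonempty → V ⊆ U → ¬ IsMeagre (L ∩ V) :=
  ⟨fun h _ hVo hVne hVU => not_isMeagre_of_subset_closure_interior h hVo hVne hVU,
    subset_closure_interior_of_not_isMeagre hK hL hU⟩

/-- **Registered sub-goal `category_transfer`** (planner side-deliverable of the companion c4), in the crux's vocabulary: if a loud set
`LOUD^{(0,a)}(S,E,ε)` is a countable union of closed sets, then for every open `U ⊆ P_S` the target-type inclusion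
`U ⊆ closure (interior LOUD)` holds iff `LOUD` is non-meagre in every non-empty open subset of `U`. [folklore] -/
theorem category_transfer : ∀ (S : Finset (Fin 3 → ℤ)) (a E ε : ℝ) (K : ℕ → Set (Coeff S)) (U : Set (Coeff S)), (∀ n, IsClosed (K n)) → loud S a E ε = ⋃ n, K n → IsOpen U → (U ⊆ closure (interior (loud S a E ε)) ↔ ∀ V : Set (Coeff S), IsOpen V → V.Nonempty → V ⊆ U → ¬ IsMeagre (loud S a E ε ∩ V)) :=
  fun _ _ _ _ _ _ hK hL hU => subset_closure_interior_iff_not_isMeagre hK hL hU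

end Summit.AnomalousDissipation.AnomalousDissipation.Theorems.RobustLoudUpgrade.CategoryTransfer

end
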